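import Mathlib
import Literature.Analysis.FunctionSpaces.PoissonPointProcess
import Literature.Probability.Percolation.CardyFormula

/-!
# Sketch — first lemmas of three crux ideas for `VoronoiHubFromSmirnov`
(stmt-CriticalPhenomena-6433, route CardyFlipRusso). Elaboration check only; proofs are `sorry`.
-/

open MeasureTheory Complex

namespace Summit.CriticalPhenomena.CardyFormulaZ2.Cruxes.VoronoiHubFromSmirnov.Sketch

open Literature.Analysis.FunctionSpaces

/-- Card A (annealed-morera-palm-defect), first lemma = the isotropy selection rule for Palm means:
a spin-`m` (`m ≠ 0`) rotation-covariant integrable functional of a point configuration has zero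
mean under any rotation-invariant law. (`rot θ` = rotation of configurations by angle `θ`, given
abstractly through its membership characterisation.) -/
theorem spin_selection (P : Measure (PointConfig ℂ)) [IsProbabilityMeasure P]
    (rot : ℝ → PointConfig ℂ → PointConfig ℂ)
    (hrot : ∀ θ (c : PointConfig ℂ) (z : ℂ), z ∈ rot θ c ↔ exp (-(θ : ℂ) * I) * z ∈ c)
    (hmeas : ∀ θ, Measurable (rot θ)) (hinv : ∀ θ, P.map (rot θ) = P)
    (m : ℤ) (hm : m ≠ 0) (Ψ : PointConfig ℂ → ℂ) (hΨ : Integrable Ψ P)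
    (hspin : ∀ θ c, Ψ (rot θ c) = exp ((m : ℂ) * (θ : ℂ) * I) * Ψ c) :
    ∫ c, Ψ c ∂P = 0 := by
  sorry

/-- Card B (moebius-exact-delaunay), first lemma = Möbius-exactness of Delaunay adjacency: an
empty-circumdisc witness for the pair `x, y` of a locally finite set `X` is carried by a Möbius map
whose pole lies outside the closed witness disc to an empty-circumdisc witness for `ψ x, ψ y`. -/
theorem delaunayEdge_moebius (a b c d : ℂ) (had : a * d - b * c ≠ 0) (X : Set ℂ) (x y : ℂ)
    (hx : x ∈ X) (hy : y ∈ X) (z₀ : ℂ) (r : ℝ) (hr : 0 < r)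
    (hxs : dist x z₀ = r) (hys : dist y z₀ = r) (hempty : ∀ p ∈ X, r ≤ dist p z₀)
    (hpole : c ≠ 0 → r < dist (-d / c) z₀) :
    let ψ : ℂ → ℂ := fun p => (a * p + b) / (c * p + d)
    ∃ w₀ : ℂ, ∃ s : ℝ, 0 < s ∧ dist (ψ x) w₀ = s ∧ dist (ψ y) w₀ = s ∧
      ∀ p ∈ X, s ≤ dist (ψ p) w₀ := by
  sorry

/-- Card C (hyperbolic-intensity-exact-ci), first lemma = the hyperbolic intensity
`(1 - |z|²)⁻²` is exactly invariant under every automorphism `ψ(z) = e^{iθ}(z - a)/(1 - ā z)` of the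
unit disc (`|ψ'|² ρ∘ψ = ρ`), whence (mapping theorem) the Poisson law of that intensity, the
Möbius-invariant Delaunay adjacency and the fair colouring are `Aut(𝔻)`-invariant in law. -/
theorem hypDensity_invariant (a : ℂ) (ha : ‖a‖ < 1) (θ : ℝ) (z : ℂ) (hz : ‖z‖ < 1) :
    let ψ : ℂ → ℂ := fun w => exp ((θ : ℂ) * I) * (w - a) / (1 - (starRingEnd ℂ a) * w)
    ‖deriv ψ z‖ ^ 2 / (1 - ‖ψ z‖ ^ 2) ^ 2 = 1 / (1 - ‖z‖ ^ 2) ^ 2 := by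
  sorry

/-- Card C, the exact-symmetry payoff in the tree's vocabulary (shape only): if a crossing
functional of conformal rectangles carried by the closed unit disc is invariant under all disc
automorphisms extended to the boundary, it is a function of the cross-ratio of the boundary
preimages. Stated for an abstract functional `G` on 4-tuples of boundary points. -/
theorem crossRatio_function_of_autInvariant (G : (Fin 4 → ℂ) → ℝ)
    (hG : ∀ (a : ℂ), ‖a‖ < 1 → ∀ (θ : ℝ) (p : Fin 4 → ℂ), (∀ i, ‖p i‖ = 1) →
      G (fun i => exp ((θ : ℂ) * I) * (p i - a) / (1 - (starRingEnd ℂ a) * p i)) = G p) :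
    ∃ F : ℝ → ℝ, ∀ (p : Fin 4 → ℂ) (x : Fin 4 → ℝ), (∀ i, ‖p i‖ = 1) → StrictMono x →
      (∀ i, p i = (x i - I) / (x i + I)) →
      G p = F (Literature.Probability.RandomPlanarGeometry.crossRatio x) := by
  sorry

end Summit.CriticalPhenomena.CardyFormulaZ2.Cruxes.VoronoiHubFromSmirnov.Sketch
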